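import Summits.NavierStokesRegularity.NavierStokesRegularity.Theorems.TypeIIInviscidRelaxationAxisymSwirlRegularZhangBarrierRiccati
import HarnessLib

/-!
# Toward the κ-inflow barriers, `κ ∈ (0,1]`: the Riccati inequality for the ELEMENTARY tail (abstract form)

Helper toward the crux `AxisymSwirlRegular` (stmt-NavierStokesRegularity-1964, route TypeIIInviscidRelaxation),
registered line `radial_inflow_split`, criterion side (⟨19059⟩); theorems only.

The recommended (fully elementary) recipe for the self-similar barrier of the envelope `M r^{κ−1}(T−t)^{−κ/2}`
(hand 2-g1 census on ⟨1964⟩, numerically verified): `u = 1 − e^{−h}`, `h = (M/κ)ξ^κ`;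
`φ = A ξ^{κ−1} e^{−h} + 2ξ^{1−κ}/√(1+W²)` with `W = ξ^{2−κ} − 2M`, whose primitive
`ψ = −(A/M)e^{−h} + (2/(2−κ)) arsinh W` is elementary; `v = e^{mψ}`, `F = u·v`.  In the atoms
`ρ = ξ^{1−κ}` (`ξ^{κ−1} = ρ⁻¹`, `ξ^{−κ} = ρ/ξ`, `ξ^{2−2κ} = ρ²`, `W = ξρ − 2M`), `S = √(1+W²)`, `Q = A e^{−h}`, the Riccati
expression `φ′ + (Mξ^{κ−1} − 1/ξ − ξ/2)φ + mφ²` equals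
`−(Q/ρ)((2−κ)/ξ + ξ/2) − W/S − 2κρ/(ξS) − 2(2−κ)ρ²W/S³ + m(Q/ρ + 2ρ/S)²`.

THIS FILE: `riccati_abstractW` — that expression is `≤ −1` under the structural hypotheses `0 < ξ`, `0 < κ ≤ 1`,
`0 < M`, `0 < ρ`, the rpow monotonicity facts `ξ ≥ 1 ⇒ 1 ≤ ρ ≤ ξ`, `ξ ≤ 1 ⇒ ξ ≤ ρ ≤ 1`, `S² = 1+W²`, `0 < Q ≤ A`,
`32(A+2)(1+2M)m = 1`, and `Q ≥ 8(1+2M)²` wherever `W < 1` (for the actual functions: `W < 1 ⇒ ξ^κ ≤ 1+2M ⇒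
h ≤ M(1+2M)/κ`, so `A = 8(1+2M)² e^{M(1+2M)/κ}` works).  Region `W ≥ 1` is the κ = 1 tail lemma `tail_region_one`
with `y = W` plus `ρ² ≥ 1`; region `W < 1` is bookkeeping (`ρ² ≤ 1+2M`).  The sibling `…RiccatiKappa(Calc)` files treat
the alternative tail `2/√(1+(ξ − 2Mξ^{κ−1})²)` (non-elementary primitive).

Pure Mathlib real algebra; no NS statement here. [new]
-/

noncomputable section

set_option linter.dupNamespace false

open Set Real

namespace Summit.NavierStokesRegularity.NavierStokesRegularity.Theorems.ZhangBarrier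

/-- Constants bookkeeping: `32(A+2)(1+2M)m = 1` gives `2mA ≤ 1/8`, `8m(1+2M) ≤ 1/4`, `16m ≤ 1`. -/
theorem mconsts {A M m : ℝ} (hA : 0 < A) (hM : 0 < M) (hm0 : 0 < m)
    (hmA : 32 * (A + 2) * (1 + 2 * M) * m = 1) :
    2 * m * A ≤ 1 / 8 ∧ 8 * m * (1 + 2 * M) ≤ 1 / 4 ∧ 16 * m ≤ 1 := by
  have hM1 : 1 ≤ 1 + 2 * M := by linarith
  have hKm : (A + 2) * (1 + 2 * M) * m = 1 / 32 := by linarith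
  have hK1 : (A + 2) * 1 ≤ (A + 2) * (1 + 2 * M) := mul_le_mul_of_nonneg_left hM1 (by linarith)
  have hK2' : 1 * (1 + 2 * M) ≤ (A + 2) * (1 + 2 * M) := mul_le_mul_of_nonneg_right (by linarith) (by linarith)
  have hKA : A * m ≤ (A + 2) * (1 + 2 * M) * m := by
    apply mul_le_mul_of_nonneg_right _ hm0.le; linarith
  have hKM : (1 + 2 * M) * m ≤ (A + 2) * (1 + 2 * M) * m := by
    apply mul_le_mul_of_nonneg_right _ hm0.le; linarith
  have hK2 : 2 * m ≤ (A + 2) * (1 + 2 * M) * m := by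
    apply mul_le_mul_of_nonneg_right _ hm0.le; linarith
  refine ⟨by linarith, by linarith, by linarith⟩

/-- The quadratic term: `m(Q/ρ + 2ρ/S)² ≤ (1/8)(Q/ρ)((2−κ)/ξ + ξ/2) + 8mρ²/S²` when `2mQ ≤ 1/8` and
`ρ⁻¹ ≤ (2−κ)/ξ + ξ/2`. -/
theorem quad_term_le {ξ κ ρ S Q m : ℝ} (hρ : 0 < ρ) (hQ0 : 0 < Q) (hm0 : 0 < m)
    (h2 : 2 * m * Q ≤ 1 / 8) (hρbr : ρ⁻¹ ≤ (2 - κ) / ξ + ξ / 2) :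
    m * (Q / ρ + 2 * ρ / S) ^ 2 ≤ (1 / 8) * (Q / ρ * ((2 - κ) / ξ + ξ / 2)) + 8 * m * ρ ^ 2 / S ^ 2 := by
  have hsq : m * (Q / ρ + 2 * ρ / S) ^ 2 ≤ 2 * m * (Q / ρ) ^ 2 + 8 * m * ρ ^ 2 / S ^ 2 := by
    have h : (Q / ρ + 2 * ρ / S) ^ 2 ≤ 2 * (Q / ρ) ^ 2 + 2 * (2 * ρ / S) ^ 2 := by
      nlinarith [sq_nonneg (Q / ρ - 2 * ρ / S)]
    have := mul_le_mul_of_nonneg_left h hm0.le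
    have e : m * (2 * (Q / ρ) ^ 2 + 2 * (2 * ρ / S) ^ 2) = 2 * m * (Q / ρ) ^ 2 + 8 * m * ρ ^ 2 / S ^ 2 := by
      ring
    linarith
  have hφ1pos : 0 < Q / ρ := by positivity
  have h1 : 2 * m * (Q / ρ) ^ 2 = ((2 * m * Q) * ρ⁻¹) * (Q / ρ) := by rw [div_eq_mul_inv]; ring
  have h3 : (2 * m * Q) * ρ⁻¹ ≤ (1 / 8) * ((2 - κ) / ξ + ξ / 2) :=
    mul_le_mul h2 hρbr (inv_pos.2 hρ).le (by norm_num)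
  have h4 := mul_le_mul_of_nonneg_right h3 hφ1pos.le
  rw [h1] at hsq
  linarith

/-- Region `W ≥ 1` of `riccati_abstractW`: the tail alone, `−W/S − 2(2−κ)ρ²W/S³ + 8mρ²/S² ≤ −1` for `ρ ≥ 1`,
`16m ≤ 1` (the κ = 1 lemma `tail_region_one` with `y = W`, plus `ρ² ≥ 1`). -/
theorem tailW_region_one {κ ρ W S m : ℝ} (hκ1 : κ ≤ 1) (hρ1 : 1 ≤ ρ) (hW1 : 1 ≤ W) (hS : 0 < S)
    (hSW : S ^ 2 = 1 + W ^ 2) (hm0 : 0 < m) (hm16 : 16 * m ≤ 1) :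
    -(W / S) - 2 * (2 - κ) * ρ ^ 2 * W / S ^ 3 + 8 * m * ρ ^ 2 / S ^ 2 ≤ -1 := by
  have hG : 1 ≤ ρ ^ 2 := one_le_pow₀ hρ1
  have htail := tail_region_one hS hSW hW1 hm16
  have hW0 : 0 ≤ W := by linarith
  have hS2W : S ≤ 2 * W := by
    refine (pow_le_pow_iff_left₀ hS.le (by linarith) two_ne_zero).1 ?_
    have : 1 ≤ W ^ 2 := one_le_pow₀ hW1
    rw [hSW]; nlinarith
  have hA1 : -(2 * (2 - κ) * ρ ^ 2 * W) / S ^ 3 ≤ -(2 * ρ ^ 2 * W) / S ^ 3 := by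
    apply div_le_div_of_nonneg_right _ (by positivity)
    have h0 : 0 ≤ (1 - κ) * (ρ ^ 2 * W) := mul_nonneg (by linarith) (by positivity)
    have e0 : -(2 * (2 - κ) * ρ ^ 2 * W) = -(2 * ρ ^ 2 * W) - 2 * ((1 - κ) * (ρ ^ 2 * W)) := by ring
    rw [e0]; linarith
  have hneg : -(2 * W) / S ^ 3 + 8 * m / S ^ 2 ≤ 0 := by
    have e0 : -(2 * W) / S ^ 3 + 8 * m / S ^ 2 = (8 * m * S - 2 * W) / S ^ 3 := by
      field_simp; ring
    rw [e0]
    apply div_nonpos_of_nonpos_of_nonneg _ (by positivity)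
    have h1 : m * S ≤ m * (2 * W) := mul_le_mul_of_nonneg_left hS2W hm0.le
    have h2 : 16 * m * W ≤ 1 * W := mul_le_mul_of_nonneg_right hm16 hW0
    linarith
  have hextra : (ρ ^ 2 - 1) * (-(2 * W) / S ^ 3 + 8 * m / S ^ 2) ≤ 0 :=
    mul_nonpos_of_nonneg_of_nonpos (by linarith) hneg
  have e1 : -(2 * ρ ^ 2 * W) / S ^ 3 + 8 * m * ρ ^ 2 / S ^ 2
      = (-(2 * W) / S ^ 3 + 8 * m / S ^ 2) + (ρ ^ 2 - 1) * (-(2 * W) / S ^ 3 + 8 * m / S ^ 2) := by ring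
  have e2 : -(2 * (2 - κ) * ρ ^ 2 * W / S ^ 3) = -(2 * (2 - κ) * ρ ^ 2 * W) / S ^ 3 := by ring
  have e3 : -(W / S) = -W / S := by ring
  have e4 : -(2 * W) / S ^ 3 = -(2 * W) / S ^ 3 := rfl
  linarith

/-- Region `W < 1` of `riccati_abstractW`: the tail's terms are bounded,
`−W/S − 2(2−κ)ρ²W/S³ + 8mρ²/S² ≤ 1 + 4(1+2M) + 1/4` for `ρ² ≤ 1 + 2M`, `8m(1+2M) ≤ 1/4`. -/
theorem tailW_region_two {κ ρ W S m M : ℝ} (hκ0 : 0 < κ) (hκ1 : κ ≤ 1) (hS : 0 < S)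
    (hSW : S ^ 2 = 1 + W ^ 2) (hm0 : 0 < m) (hm8 : 8 * m * (1 + 2 * M) ≤ 1 / 4) (hρ2 : ρ ^ 2 ≤ 1 + 2 * M) :
    -(W / S) - 2 * (2 - κ) * ρ ^ 2 * W / S ^ 3 + 8 * m * ρ ^ 2 / S ^ 2 ≤ 1 + 4 * (1 + 2 * M) + 1 / 4 := by
  have hS1 : 1 ≤ S :=
    (pow_le_pow_iff_left₀ zero_le_one hS.le two_ne_zero).1 (by rw [one_pow, hSW]; nlinarith [sq_nonneg W])
  have hWS : -W ≤ S := by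
    rcases le_or_gt 0 W with h0 | h0
    · linarith
    · have : (-W) ^ 2 ≤ S ^ 2 := by rw [hSW, neg_sq]; linarith
      exact (pow_le_pow_iff_left₀ (by linarith) hS.le two_ne_zero).1 this
  have hT1 : -(W / S) ≤ 1 := by rw [← neg_div, div_le_iff₀ hS]; linarith
  have hT2 : -(2 * (2 - κ) * ρ ^ 2 * W / S ^ 3) ≤ 4 * (1 + 2 * M) := by
    have hS3 : S ≤ S ^ 3 := by
      have : 0 ≤ S * (S ^ 2 - 1) := mul_nonneg hS.le (by rw [hSW]; nlinarith [sq_nonneg W])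
      nlinarith
    have hq : -W / S ^ 3 ≤ 1 := by
      rw [div_le_iff₀ (by positivity)]; linarith
    have hcoef : 0 ≤ 2 * (2 - κ) * ρ ^ 2 := by
      have : 0 ≤ 2 - κ := by linarith
      positivity
    have e0 : -(2 * (2 - κ) * ρ ^ 2 * W / S ^ 3) = (2 * (2 - κ) * ρ ^ 2) * (-W / S ^ 3) := by ring
    rw [e0]
    have h1 : (2 * (2 - κ) * ρ ^ 2) * (-W / S ^ 3) ≤ (2 * (2 - κ) * ρ ^ 2) * 1 :=
      mul_le_mul_of_nonneg_left hq hcoef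
    have h2 : 2 * (2 - κ) * ρ ^ 2 ≤ 2 * 2 * (1 + 2 * M) := by
      have : (2 - κ) * ρ ^ 2 ≤ 2 * (1 + 2 * M) :=
        mul_le_mul (by linarith) hρ2 (sq_nonneg ρ) (by norm_num)
      linarith
    linarith
  have hT3 : 8 * m * ρ ^ 2 / S ^ 2 ≤ 1 / 4 := by
    rw [div_le_iff₀ (by positivity)]
    have : 8 * m * ρ ^ 2 ≤ 8 * m * (1 + 2 * M) := by nlinarith
    nlinarith
  linarith

/-- **Riccati inequality, elementary κ-tail, abstract form** (see the module docstring for the atoms). [new] -/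
theorem riccati_abstractW {ξ κ M ρ W S Q A m : ℝ} (hξ : 0 < ξ) (hκ0 : 0 < κ) (hκ1 : κ ≤ 1) (hM : 0 < M)
    (hρ : 0 < ρ) (hρa : 1 ≤ ξ → 1 ≤ ρ ∧ ρ ≤ ξ) (hρb : ξ ≤ 1 → ξ ≤ ρ ∧ ρ ≤ 1)
    (hW : W = ξ * ρ - 2 * M) (hS : 0 < S) (hSW : S ^ 2 = 1 + W ^ 2)
    (hQ0 : 0 < Q) (hQA : Q ≤ A) (hm0 : 0 < m) (hmA : 32 * (A + 2) * (1 + 2 * M) * m = 1)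
    (hlow : W < 1 → 8 * (1 + 2 * M) ^ 2 ≤ Q) :
    -(Q / ρ * ((2 - κ) / ξ + ξ / 2)) - W / S - 2 * κ * ρ / (ξ * S) - 2 * (2 - κ) * ρ ^ 2 * W / S ^ 3
      + m * (Q / ρ + 2 * ρ / S) ^ 2 ≤ -1 := by
  have hA : 0 < A := hQ0.trans_le hQA
  have hM1 : 1 ≤ 1 + 2 * M := by linarith
  obtain ⟨hm16A, hm8, hm16⟩ := mconsts hA hM hm0 hmA
  have hξinv : 1 ≤ ξ⁻¹ + ξ / 2 := by
    rw [inv_eq_one_div, ← sub_nonneg]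
    have : 1 / ξ + ξ / 2 - 1 = ((ξ - 1) ^ 2 + 1) / (2 * ξ) := by field_simp; ring
    rw [this]; positivity
  have hdiv : ξ⁻¹ ≤ (2 - κ) / ξ := by
    rw [inv_eq_one_div]; exact div_le_div_of_nonneg_right (by linarith) hξ.le
  have hbr : ξ⁻¹ ≤ (2 - κ) / ξ + ξ / 2 := by linarith [show (0:ℝ) ≤ ξ / 2 by positivity]
  have hbr1 : 1 ≤ (2 - κ) / ξ + ξ / 2 := by linarith
  have hρbr : ρ⁻¹ ≤ (2 - κ) / ξ + ξ / 2 := by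
    rcases le_or_gt ξ 1 with h1 | h1
    · have := (hρb h1).1
      have : ρ⁻¹ ≤ ξ⁻¹ := inv_anti₀ hξ this
      linarith
    · have := (hρa h1.le).1
      have : ρ⁻¹ ≤ 1 := inv_le_one_of_one_le₀ this
      linarith
  have h2 : 2 * m * Q ≤ 1 / 8 := by
    have := mul_le_mul_of_nonneg_left hQA (by positivity : (0:ℝ) ≤ 2 * m); linarith
  have hquad := quad_term_le (κ := κ) (ξ := ξ) (S := S) hρ hQ0 hm0 h2 hρbr
  have hκterm : 0 ≤ 2 * κ * ρ / (ξ * S) := by positivity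
  have hgoodpos : 0 ≤ Q / ρ * ((2 - κ) / ξ + ξ / 2) := by positivity
  rcases le_or_gt 1 W with hW1 | hW1
  · -- region `W ≥ 1`: `ξ ≥ 1`, `ρ ≥ 1`
    have hξ1 : 1 ≤ ξ := by
      by_contra h
      push Not at h
      have hρ1 := (hρb h.le).2
      have : ξ * ρ ≤ 1 * 1 := mul_le_mul h.le hρ1 hρ.le zero_le_one
      rw [hW] at hW1; linarith
    have hρ1 : 1 ≤ ρ := (hρa hξ1).1
    have htail := tailW_region_one hκ1 hρ1 hW1 hS hSW hm0 hm16
    linarith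
  · -- region `W < 1`
    have hQ := hlow hW1
    have hρ2 : ρ ^ 2 ≤ 1 + 2 * M := by
      rcases le_or_gt ξ 1 with h1 | h1
      · have := pow_le_one₀ hρ.le (hρb h1).2 (n := 2); linarith
      · have h2' := (hρa h1.le).2
        have h3 : ξ * ρ < 1 + 2 * M := by rw [hW] at hW1; linarith
        have h4 : ρ * ρ ≤ ξ * ρ := mul_le_mul_of_nonneg_right h2' hρ.le
        rw [sq]; linarith
    have htail := tailW_region_two (W := W) (M := M) hκ0 hκ1 hS hSW hm0 hm8 hρ2
    -- the good term: `(Q/ρ)((2−κ)/ξ + ξ/2) ≥ Q/(1+2M) ≥ 8(1+2M)`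
    have hgood : Q / (1 + 2 * M) ≤ Q / ρ * ((2 - κ) / ξ + ξ / 2) := by
      rcases le_or_gt ξ 1 with h1 | h1
      · have hρ1 := (hρb h1).2
        calc Q / (1 + 2 * M) ≤ Q / 1 := div_le_div_of_nonneg_left hQ0.le one_pos hM1
          _ ≤ Q / ρ := div_le_div_of_nonneg_left hQ0.le hρ hρ1
          _ = Q / ρ * 1 := (mul_one _).symm
          _ ≤ Q / ρ * ((2 - κ) / ξ + ξ / 2) := by gcongr
      · have h3 : ξ * ρ < 1 + 2 * M := by rw [hW] at hW1; linarith
        have hξρ : 0 < ξ * ρ := by positivity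
        calc Q / (1 + 2 * M) ≤ Q / (ξ * ρ) := div_le_div_of_nonneg_left hQ0.le hξρ h3.le
          _ = Q / ρ * ξ⁻¹ := by field_simp
          _ ≤ Q / ρ * ((2 - κ) / ξ + ξ / 2) := by gcongr
    have hQ' : 8 * (1 + 2 * M) ≤ Q / (1 + 2 * M) := by
      rw [le_div_iff₀ (by positivity)]; rw [sq] at hQ; linarith
    linarith

end Summit.NavierStokesRegularity.NavierStokesRegularity.Theorems.ZhangBarrier

end
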